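import Summits.QuantumFields.BalabanUV.T4Continuum.Spine.NE7.SpineRemainderRate
import Summits.QuantumFields.BalabanUV.T4Continuum.Spine.NE7.SpineRemainderRateLog

/-!
# Spine/NE7/SpineRemainderRateHybrid — NE7's FULL remainder in the slot is the HYBRID one, `hybridDelta vol δ W` (term-wise half `δ`
# = this row's `Core`, weight half `W` = rows NE7b ∕ NE7c); its rate of approach is the SUM of the two halves' tails, so the slower
# half sets the rate: both geometric ⟹ a power of the spacing (file 45), one polynomial ⟹ logarithmic in the spacing (file 46)

Cell `pub-balaban-gaps` (YM blitz Y1, track G2, seat `ne7`, generation 13).  49th `Spine/NE7/` file; 0 `def`, 0 sorry; [folklore] +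
[bookkeeping]; the capstone of files 45 ∕ 46 for the remainder the kernel's node U5 actually outputs.

WHY.  `T4MatchingAssembly.HybridNE7.matchingModConstants` delivers NE7 with remainder `T4HybridMatching.hybridDelta vol δ (W + Wsh)`
(`δ K + (−log(1 − W K − Wsh K))∕vol`), and `T4TermwiseClosure.hybridDelta_le_of_le` majorises it by `d K + 2·w K∕vol` when `δ ≤ d`,
`0 ≤ W + Wsh ≤ w ≤ ½` («whichever of the term-wise half `d` and the weight half `w` decays slower setting the rate», its docstring).  §1 makes
that sentence a tail bound: `|genFun Z K t − genFunLim Z t| ≤ 2·vol·Σ_{m≥0} d(K+m) + 4·Σ_{m≥0} w(K+m)`.  §2: both halves of the shape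
`D·(K+1)^m·q^K` ⟹ rate `(2·vol·D₁ + 4·D₂)·(K+1)^m·q^K·Σ_j (j+1)^m q^j` (file 45's tail); §3: term-wise half geometric but weight half only
`D₂·(K+1)^{−(m′+2)}` ⟹ the rate is the polynomial one of file 46 up to the geometric tail — logarithmic in the spacing.  Which shape rows
NE7b ∕ NE7c (`W`, `Wsh`) deliver is THEIR business (`T4WeightBudget.RelWeightBound`, `T4IndicatorShell.ShellWeightBound` give summability with
the window-level bookkeeping; the kernel's necessity lemmas `T4BadClassBooking.not_summable_ageWeight_of_ageOnly` etc. say what does not);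
this file prices the outcomes only; §4 adds that WITH NE7b's weight majorant of record (`V·r^{K − j⋆(K)}`, a positive fraction of old steps —
`T4WeightBudget.summable_weightMajorant`'s shape) the weight half IS geometric (ratio `r^c`), so NE7's full remainder has file 45's power-law
rate iff the term-wise half does (`abs_genFun_sub_lim_le_of_hybrid_weightMajorant`).

HONEST FRAMING.  [folklore] real analysis over the HYPOTHESIS `MatchingModConstants vol l₀ (hybridDelta vol δ W) Z`; nothing of Bałaban's
asserted; NE7 NOT proved and NOT in print; spine 0∕9; one fixed finite T⁴ — NOT ℝ⁴, NOT infinite volume, NOT a mass gap, NOT Clay.  R10.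
-/

noncomputable section

open Finset
open scoped BigOperators

namespace Summit.QuantumFields.BalabanUV.T4Continuum.Spine.NE7

open Literature.MathematicalPhysics.QuantumFieldTheory.Balaban1983to89
open Literature.MathematicalPhysics.QuantumFieldTheory.Balaban1983to89.T4CauchySum
open Literature.MathematicalPhysics.QuantumFieldTheory.Balaban1983to89.T4HybridMatching (hybridDelta)
open Literature.MathematicalPhysics.QuantumFieldTheory.Balaban1983to89.T4TermwiseClosure

/-! ## §1 The hybrid remainder's tail is the sum of the two halves' tails -/

/-- **HYBRID TAIL**: under `MatchingModConstants vol l₀ (hybridDelta vol δ Wb) Z` with `δ ≤ d`, `0 ≤ Wb ≤ w ≤ ½` and `d`, `w` summable,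
`|genFun Z K t − genFunLim Z t| ≤ 2·vol·Σ_{m≥0} d (K+m) + 4·Σ_{m≥0} w (K+m)` on `|t| ≤ l₀` (`abs_genFun_sub_lim_le_of_le` with the majorant
`d + 2w∕vol` of `hybridDelta_le_of_le`, and the sum split). [folklore] -/
theorem abs_genFun_sub_lim_le_of_hybrid {vol l₀ : ℝ} {δ Wb d w : ℕ → ℝ} {Z : ℕ → ℝ → ℝ}
    (h : MatchingModConstants vol l₀ (hybridDelta vol δ Wb) Z) (hvol : 0 < vol) (hl₀ : 0 ≤ l₀)
    (hδ : ∀ K, δ K ≤ d K) (hW0 : ∀ K, 0 ≤ Wb K) (hW : ∀ K, Wb K ≤ w K) (hw : ∀ K, w K ≤ 1 / 2)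
    (hd : Summable d) (hws : Summable w) {t : ℝ} (ht : |t| ≤ l₀) (K : ℕ) :
    |genFun Z K t - genFunLim Z t| ≤ 2 * vol * ∑' m : ℕ, d (K + m) + 4 * ∑' m : ℕ, w (K + m) := by
  have hmaj : ∀ K, hybridDelta vol δ Wb K ≤ d K + 2 * w K / vol := fun K => hybridDelta_le_of_le hvol hδ hW0 hW hw K
  have hsum : Summable (fun K => d K + 2 * w K / vol) := hd.add ((hws.mul_left 2).div_const vol)
  refine (abs_genFun_sub_lim_le_of_le h hvol hl₀ hmaj hsum ht K).trans (le_of_eq ?_)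
  have hdK : Summable (fun m : ℕ => d (K + m)) := hd.comp_injective (add_right_injective K)
  have hwK : Summable (fun m : ℕ => w (K + m)) := hws.comp_injective (add_right_injective K)
  have hwK' : Summable (fun m : ℕ => 2 * w (K + m) / vol) := (hwK.mul_left 2).div_const vol
  rw [hdK.tsum_add hwK']
  have e : ∑' m : ℕ, 2 * w (K + m) / vol = 2 / vol * ∑' m : ℕ, w (K + m) := by
    rw [← tsum_mul_left]; exact tsum_congr fun m => by ring
  rw [e]
  field_simp
  ring

/-! ## §2 Both halves geometric × polynomial ⟹ a power of the spacing -/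

/-- **BOTH HALVES GEOMETRIC**: `d K ≤ D₁·(K+1)^m·q^K`, `w K ≤ D₂·(K+1)^m·q^K` (`0 ≤ D₁, D₂`, `0 ≤ q < 1`) ⟹
`|genFun Z K t − genFunLim Z t| ≤ (2·vol·D₁ + 4·D₂)·((K+1)^m·q^K)·Σ_j (j+1)^m q^j` — the rate of file 45 (`a^{β′}` up to logs, `pow_eq_spacing_rpow`)
for NE7's full remainder. [folklore] -/
theorem abs_genFun_sub_lim_le_of_hybrid_geometric {vol l₀ D₁ D₂ q : ℝ} {m : ℕ} {δ Wb d w : ℕ → ℝ} {Z : ℕ → ℝ → ℝ}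
    (h : MatchingModConstants vol l₀ (hybridDelta vol δ Wb) Z) (hvol : 0 < vol) (hl₀ : 0 ≤ l₀)
    (hδ : ∀ K, δ K ≤ d K) (hW0 : ∀ K, 0 ≤ Wb K) (hW : ∀ K, Wb K ≤ w K) (hw : ∀ K, w K ≤ 1 / 2)
    (hD₁ : 0 ≤ D₁) (hD₂ : 0 ≤ D₂) (hq0 : 0 ≤ q) (hq1 : q < 1)
    (hdle : ∀ K, d K ≤ D₁ * ((((K : ℕ) : ℝ) + 1) ^ m * q ^ K)) (hwle : ∀ K, w K ≤ D₂ * ((((K : ℕ) : ℝ) + 1) ^ m * q ^ K))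
    (hd0 : ∀ K, 0 ≤ d K) {t : ℝ} (ht : |t| ≤ l₀) (K : ℕ) :
    |genFun Z K t - genFunLim Z t|
      ≤ (2 * vol * D₁ + 4 * D₂) * (((((K : ℕ) : ℝ) + 1) ^ m * q ^ K) * ∑' j : ℕ, ((((j : ℕ) : ℝ) + 1) ^ m * q ^ j)) := by
  have hgeo : Summable (fun K : ℕ => (((K : ℕ) : ℝ) + 1) ^ m * q ^ K) := summable_succ_pow_mul_geometric hq0 hq1 m
  have hw0 : ∀ K, 0 ≤ w K := fun K => (hW0 K).trans (hW K)
  have hd : Summable d := Summable.of_nonneg_of_le hd0 hdle (hgeo.mul_left D₁)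
  have hws : Summable w := Summable.of_nonneg_of_le hw0 hwle (hgeo.mul_left D₂)
  refine (abs_genFun_sub_lim_le_of_hybrid h hvol hl₀ hδ hW0 hW hw hd hws ht K).trans ?_
  -- each tail against the geometric × polynomial tail of file 45
  have hT := tsum_tail_succ_pow_mul_geometric_le hq0 hq1 m K
  have hgeoK : Summable (fun j : ℕ => (((K + j : ℕ) : ℝ) + 1) ^ m * q ^ (K + j)) := hgeo.comp_injective (add_right_injective K)
  have hdK : Summable (fun j : ℕ => d (K + j)) := hd.comp_injective (add_right_injective K)
  have hwK : Summable (fun j : ℕ => w (K + j)) := hws.comp_injective (add_right_injective K)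
  have h1 : ∑' j : ℕ, d (K + j) ≤ D₁ * (((((K : ℕ) : ℝ) + 1) ^ m * q ^ K) * ∑' j : ℕ, ((((j : ℕ) : ℝ) + 1) ^ m * q ^ j)) := by
    calc ∑' j : ℕ, d (K + j) ≤ ∑' j : ℕ, D₁ * ((((K + j : ℕ) : ℝ) + 1) ^ m * q ^ (K + j)) :=
          Summable.tsum_le_tsum (fun j => hdle (K + j)) hdK (hgeoK.mul_left D₁)
      _ = D₁ * ∑' j : ℕ, (((K + j : ℕ) : ℝ) + 1) ^ m * q ^ (K + j) := tsum_mul_left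
      _ ≤ _ := mul_le_mul_of_nonneg_left hT hD₁
  have h2 : ∑' j : ℕ, w (K + j) ≤ D₂ * (((((K : ℕ) : ℝ) + 1) ^ m * q ^ K) * ∑' j : ℕ, ((((j : ℕ) : ℝ) + 1) ^ m * q ^ j)) := by
    calc ∑' j : ℕ, w (K + j) ≤ ∑' j : ℕ, D₂ * ((((K + j : ℕ) : ℝ) + 1) ^ m * q ^ (K + j)) :=
          Summable.tsum_le_tsum (fun j => hwle (K + j)) hwK (hgeoK.mul_left D₂)
      _ = D₂ * ∑' j : ℕ, (((K + j : ℕ) : ℝ) + 1) ^ m * q ^ (K + j) := tsum_mul_left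
      _ ≤ _ := mul_le_mul_of_nonneg_left hT hD₂
  have hv : 0 ≤ 2 * vol := by positivity
  nlinarith [mul_le_mul_of_nonneg_left h1 hv, h2]

/-! ## §3 Term-wise half geometric, weight half polynomial ⟹ logarithmic in the spacing -/

/-- **THE SLOWER HALF SETS THE RATE**: term-wise half `d K ≤ D₁·(K+1)^m·q^K` but weight half only `w K ≤ D₂·((K+1)^{m′+2})⁻¹` ⟹
`|genFun Z K t − genFunLim Z t| ≤ 2·vol·D₁·(K+1)^m·q^K·Σ_j (j+1)^m q^j + 4·D₂·((m′+2)∕(m′+1))·((K+1)^{m′+1})⁻¹` — the second, POLYNOMIAL term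
dominates: the certified rate for NE7's full remainder is then file 46's `(1 + log_L(1∕a))^{−(m′+1)}`, logarithmic in the spacing, however
good the term-wise half is. [folklore] -/
theorem abs_genFun_sub_lim_le_of_hybrid_mixed {vol l₀ D₁ D₂ q : ℝ} {m m' : ℕ} {δ Wb d w : ℕ → ℝ} {Z : ℕ → ℝ → ℝ}
    (h : MatchingModConstants vol l₀ (hybridDelta vol δ Wb) Z) (hvol : 0 < vol) (hl₀ : 0 ≤ l₀)
    (hδ : ∀ K, δ K ≤ d K) (hW0 : ∀ K, 0 ≤ Wb K) (hW : ∀ K, Wb K ≤ w K) (hw : ∀ K, w K ≤ 1 / 2)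
    (hD₁ : 0 ≤ D₁) (hD₂ : 0 ≤ D₂) (hq0 : 0 ≤ q) (hq1 : q < 1)
    (hdle : ∀ K, d K ≤ D₁ * ((((K : ℕ) : ℝ) + 1) ^ m * q ^ K)) (hwle : ∀ K, w K ≤ D₂ * ((((K : ℕ) : ℝ) + 1) ^ (m' + 2))⁻¹)
    (hd0 : ∀ K, 0 ≤ d K) {t : ℝ} (ht : |t| ≤ l₀) (K : ℕ) :
    |genFun Z K t - genFunLim Z t|
      ≤ 2 * vol * (D₁ * (((((K : ℕ) : ℝ) + 1) ^ m * q ^ K) * ∑' j : ℕ, ((((j : ℕ) : ℝ) + 1) ^ m * q ^ j)))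
        + 4 * (D₂ * ((((m' : ℝ) + 2) / ((m' : ℝ) + 1)) * ((((K : ℕ) : ℝ) + 1) ^ (m' + 1))⁻¹)) := by
  have hgeo : Summable (fun K : ℕ => (((K : ℕ) : ℝ) + 1) ^ m * q ^ K) := summable_succ_pow_mul_geometric hq0 hq1 m
  have hw0 : ∀ K, 0 ≤ w K := fun K => (hW0 K).trans (hW K)
  have hd : Summable d := Summable.of_nonneg_of_le hd0 hdle (hgeo.mul_left D₁)
  -- summability of the polynomial majorant via file 46's tail (index shift by one)
  have hpoly : Summable (fun K : ℕ => D₂ * ((((K : ℕ) : ℝ) + 1) ^ (m' + 2))⁻¹) := by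
    obtain ⟨hs1, -⟩ := tsum_inv_pow_tail_le (le_refl (1 : ℝ)) m'
    have : Summable (fun i : ℕ => D₂ * ((((i + 1 : ℕ) : ℝ) + 1) ^ (m' + 2))⁻¹) := by
      refine (hs1.mul_left D₂).congr fun i => ?_
      push_cast; ring_nf
    exact (summable_nat_add_iff 1).mp this
  have hws : Summable w := Summable.of_nonneg_of_le hw0 hwle hpoly
  refine (abs_genFun_sub_lim_le_of_hybrid h hvol hl₀ hδ hW0 hW hw hd hws ht K).trans ?_
  have hT := tsum_tail_succ_pow_mul_geometric_le hq0 hq1 m K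
  have hgeoK : Summable (fun j : ℕ => (((K + j : ℕ) : ℝ) + 1) ^ m * q ^ (K + j)) := hgeo.comp_injective (add_right_injective K)
  have hdK : Summable (fun j : ℕ => d (K + j)) := hd.comp_injective (add_right_injective K)
  have h1 : ∑' j : ℕ, d (K + j) ≤ D₁ * (((((K : ℕ) : ℝ) + 1) ^ m * q ^ K) * ∑' j : ℕ, ((((j : ℕ) : ℝ) + 1) ^ m * q ^ j)) := by
    calc ∑' j : ℕ, d (K + j) ≤ ∑' j : ℕ, D₁ * ((((K + j : ℕ) : ℝ) + 1) ^ m * q ^ (K + j)) :=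
          Summable.tsum_le_tsum (fun j => hdle (K + j)) hdK (hgeoK.mul_left D₁)
      _ = D₁ * ∑' j : ℕ, (((K + j : ℕ) : ℝ) + 1) ^ m * q ^ (K + j) := tsum_mul_left
      _ ≤ _ := mul_le_mul_of_nonneg_left hT hD₁
  -- the weight tail: split off the `j = 0` term and use file 46's tail from `J = K + 1`
  have hwK : Summable (fun j : ℕ => w (K + j)) := hws.comp_injective (add_right_injective K)
  have hpolyK : Summable (fun j : ℕ => D₂ * ((((K + j : ℕ) : ℝ) + 1) ^ (m' + 2))⁻¹) :=
    hpoly.comp_injective (add_right_injective K)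
  have hJ : (1 : ℝ) ≤ ((K : ℕ) : ℝ) + 1 := by have := (Nat.cast_nonneg K : (0:ℝ) ≤ K); linarith
  obtain ⟨_, htail⟩ := tsum_inv_pow_tail_le hJ m'
  have hm : (0 : ℝ) < (m' : ℝ) + 1 := by positivity
  have hK1 : (0 : ℝ) < ((K : ℕ) : ℝ) + 1 := by positivity
  have hP : 0 < (((K : ℕ) : ℝ) + 1) ^ (m' + 1) := pow_pos hK1 _
  have h2 : ∑' j : ℕ, w (K + j) ≤ D₂ * ((((m' : ℝ) + 2) / ((m' : ℝ) + 1)) * ((((K : ℕ) : ℝ) + 1) ^ (m' + 1))⁻¹) := by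
    have step1 : ∑' j : ℕ, w (K + j) ≤ ∑' j : ℕ, D₂ * ((((K + j : ℕ) : ℝ) + 1) ^ (m' + 2))⁻¹ :=
      Summable.tsum_le_tsum (fun j => hwle (K + j)) hwK hpolyK
    refine step1.trans ?_
    rw [hpolyK.tsum_eq_zero_add]
    have hshift : ∑' j : ℕ, D₂ * ((((K + (j + 1) : ℕ) : ℝ) + 1) ^ (m' + 2))⁻¹
        = D₂ * ∑' j : ℕ, (((((K : ℕ) : ℝ) + 1) + 1 + (j : ℝ)) ^ (m' + 2))⁻¹ := by
      rw [← tsum_mul_left]; refine tsum_congr fun j => ?_; push_cast; ring_nf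
    rw [hshift]
    have hfirst : D₂ * ((((K + 0 : ℕ) : ℝ) + 1) ^ (m' + 2))⁻¹ ≤ D₂ * ((((K : ℕ) : ℝ) + 1) ^ (m' + 1))⁻¹ := by
      refine mul_le_mul_of_nonneg_left ?_ hD₂
      simp only [add_zero]
      refine inv_anti₀ hP ?_
      rw [pow_succ]
      exact le_mul_of_one_le_right hP.le hJ
    have hsecond : D₂ * ∑' j : ℕ, (((((K : ℕ) : ℝ) + 1) + 1 + (j : ℝ)) ^ (m' + 2))⁻¹
        ≤ D₂ * (((((K : ℕ) : ℝ) + 1) ^ (m' + 1))⁻¹ / ((m' : ℝ) + 1)) := mul_le_mul_of_nonneg_left htail hD₂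
    have e : D₂ * ((((m' : ℝ) + 2) / ((m' : ℝ) + 1)) * ((((K : ℕ) : ℝ) + 1) ^ (m' + 1))⁻¹)
        = D₂ * ((((K : ℕ) : ℝ) + 1) ^ (m' + 1))⁻¹ + D₂ * (((((K : ℕ) : ℝ) + 1) ^ (m' + 1))⁻¹ / ((m' : ℝ) + 1)) := by
      field_simp; ring
    rw [e]
    exact add_le_add hfirst hsecond
  have hv : 0 ≤ 2 * vol := by positivity
  nlinarith [mul_le_mul_of_nonneg_left h1 hv, h2]

/-! ## §4 With NE7b's weight majorant of record the weight half IS geometric -/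

/-- Row NE7b's weight majorant of record has the form `V·r^{K − j⋆(K)}` with a positive FRACTION of old steps,
`c·K ≤ K − j⋆(K)` (`T4WeightBudget.summable_weightMajorant`'s hypotheses); then it is GEOMETRIC in `K` with ratio `r^c < 1`:
`V·r^{K − j⋆(K)} ≤ V·(r^c)^K` (the comparison inside that theorem's proof, exported). [folklore] -/
theorem weightMajorant_le_geometric {r V c : ℝ} (h0 : 0 < r) (h1 : r < 1) (hV : 0 ≤ V)
    {jstar : ℕ → ℕ} (hfrac : ∀ K : ℕ, c * K ≤ ((K - jstar K : ℕ) : ℝ)) (K : ℕ) :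
    V * r ^ (K - jstar K) ≤ V * (r ^ c) ^ K := by
  refine mul_le_mul_of_nonneg_left ?_ hV
  rw [← Real.rpow_natCast r (K - jstar K), ← Real.rpow_natCast (r ^ c) K, ← Real.rpow_mul h0.le]
  exact Real.rpow_le_rpow_of_exponent_ge h0 h1.le (hfrac K)

/-- **WITH NE7b's MAJORANT, NE7's FULL REMAINDER HAS A POWER-LAW RATE IFF THE TERM-WISE HALF DOES**: term-wise half
`d K ≤ D₁·(K+1)^m·q^K`, weight half the majorant of record `w K = V·r^{K − j⋆(K)}` with `c·K ≤ K − j⋆(K)`, `0 < r < 1`, `0 < c`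
⟹ with `Q = max q (r^c) < 1`: `|genFun Z K t − genFunLim Z t| ≤ (2·vol·D₁ + 4·V)·(K+1)^m·Q^K·Σ_j (j+1)^m Q^j` — file 45's shape
(a power `a^{log_L(1∕Q)}` of the spacing up to logs).  Rows NE7b∕NE7c decide whether their majorant has this form; the kernel's
necessity lemmas (`T4BadClassBooking.not_summable_ageWeight_of_ageOnly`, …) say which bookings cannot. [folklore] -/
theorem abs_genFun_sub_lim_le_of_hybrid_weightMajorant {vol l₀ D₁ q r V c : ℝ} {m : ℕ} {jstar : ℕ → ℕ}
    {δ Wb d : ℕ → ℝ} {Z : ℕ → ℝ → ℝ}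
    (h : MatchingModConstants vol l₀ (hybridDelta vol δ Wb) Z) (hvol : 0 < vol) (hl₀ : 0 ≤ l₀)
    (hδ : ∀ K, δ K ≤ d K) (hW0 : ∀ K, 0 ≤ Wb K) (hW : ∀ K, Wb K ≤ V * r ^ (K - jstar K))
    (hw : ∀ K, V * r ^ (K - jstar K) ≤ 1 / 2)
    (hD₁ : 0 ≤ D₁) (hV : 0 ≤ V) (hq0 : 0 ≤ q) (hq1 : q < 1) (h0 : 0 < r) (h1 : r < 1) (hc : 0 < c)
    (hfrac : ∀ K : ℕ, c * K ≤ ((K - jstar K : ℕ) : ℝ))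
    (hdle : ∀ K, d K ≤ D₁ * ((((K : ℕ) : ℝ) + 1) ^ m * q ^ K)) (hd0 : ∀ K, 0 ≤ d K) {t : ℝ} (ht : |t| ≤ l₀) (K : ℕ) :
    |genFun Z K t - genFunLim Z t|
      ≤ (2 * vol * D₁ + 4 * V) * (((((K : ℕ) : ℝ) + 1) ^ m * (max q (r ^ c)) ^ K)
          * ∑' j : ℕ, ((((j : ℕ) : ℝ) + 1) ^ m * (max q (r ^ c)) ^ j)) := by
  have hrc0 : 0 ≤ r ^ c := Real.rpow_nonneg h0.le c
  have hrc1 : r ^ c < 1 := Real.rpow_lt_one h0.le h1 hc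
  have hQ0 : 0 ≤ max q (r ^ c) := hq0.trans (le_max_left _ _)
  have hQ1 : max q (r ^ c) < 1 := max_lt hq1 hrc1
  -- both halves against the common ratio `Q = max q (r^c)` and the common polynomial factor `(K+1)^m ≥ 1`
  have hK1 : ∀ K : ℕ, (1 : ℝ) ≤ (((K : ℕ) : ℝ) + 1) ^ m := fun K =>
    one_le_pow₀ (by have := (Nat.cast_nonneg K : (0:ℝ) ≤ K); linarith)
  have hdle' : ∀ K, d K ≤ D₁ * ((((K : ℕ) : ℝ) + 1) ^ m * (max q (r ^ c)) ^ K) := fun K =>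
    (hdle K).trans (mul_le_mul_of_nonneg_left (mul_le_mul_of_nonneg_left
      (pow_le_pow_left₀ hq0 (le_max_left _ _) K) (zero_le_one.trans (hK1 K))) hD₁)
  have hwle' : ∀ K, V * r ^ (K - jstar K) ≤ V * ((((K : ℕ) : ℝ) + 1) ^ m * (max q (r ^ c)) ^ K) := fun K => by
    refine (weightMajorant_le_geometric h0 h1 hV hfrac K).trans (mul_le_mul_of_nonneg_left ?_ hV)
    calc (r ^ c) ^ K ≤ (max q (r ^ c)) ^ K := pow_le_pow_left₀ hrc0 (le_max_right _ _) K
      _ = 1 * (max q (r ^ c)) ^ K := (one_mul _).symm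
      _ ≤ (((K : ℕ) : ℝ) + 1) ^ m * (max q (r ^ c)) ^ K :=
          mul_le_mul_of_nonneg_right (hK1 K) (pow_nonneg hQ0 _)
  exact abs_genFun_sub_lim_le_of_hybrid_geometric h hvol hl₀ hδ hW0 hW hw hD₁ hV hQ0 hQ1 hdle' hwle' hd0 ht K

end Summit.QuantumFields.BalabanUV.T4Continuum.Spine.NE7

end
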